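import Summits.AnomalousDissipation.AnomalousDissipation.Theorems.FloorCertificate.Negative.UniformTools

/-!
# `TaylorCertificates.FloorCertificate` (stmt-AnomalousDissipation-14091) — negative side III, tools for the
# INJECTED BEAT (`Negative/InjectedBeat.lean`, `Negative/FixedResolution.lean`)

Support lemmas (cdisprove seat `refuter-cdisprove-stmt-AnomalousDissipation-14091-g2-0`, cycle 2, 2026-08-16)
for the refutation `not_floorCertificateFixedResolution` of the bounded-resolution strengthening of the crux,
written over the tree's objects (no new definitions). They generalise the shear-specific lattice and
pair-formula lemmas of `TaylorCertificatePair/Negative/*` to an arbitrary injected mode `k₀`: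

* `wave_frequencies_gen` — wave frequencies `p = t r`, `p + q` outside the band and away from `±k₀`;
* `inertial_mode_zero`, `inertial_beat_gen` — exact inertial terms (no self-interaction of a transversal
  mode; only the `(p, p+q)` beat at `q` survives for the three-mode state);
* `coords_waves_invisible`, `laplacian_coeff_le`, `laplacian_one_le`, `laplacian_three_le`;
* `exists_fc_ne_zero_of_force`, `injection_value`, `norm_injected`, `dotc_injected` — the injected mode
  `σ f̂(k₀)` of the force and its energy input `σ ‖f̂(k₀)‖²`;
* membership facts for the mode vectors, the gain of the beat `gain_gen`, the viscosity threshold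
  `exists_threshold`.
-/

noncomputable section

set_option linter.dupNamespace false

open MeasureTheory UnitAddTorus Matrix Filter Topology
open scoped InnerProductSpace ENNReal ComplexConjugate

namespace Summit.AnomalousDissipation.AnomalousDissipation.Theorems.FloorCertificate.Negative

open Literature.Analysis.FunctionSpaces Literature.Analysis.FluidPDE
open Summit.AnomalousDissipation.AnomalousDissipation.Theses.TaylorCertificates
open Summit.AnomalousDissipation.AnomalousDissipation.Theorems.TaylorCertificatePair.Negative

/-! ### §F.1 Lattice geometry: wave frequencies far from the band and from the injected mode -/

/-- `(X + 4)² + N² ≤ (X + 5)²` when `N² ≤ X`, `0 ≤ X`. -/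
theorem numeric_bound_gen {X n : ℝ} (hX : 0 ≤ X) (hn : n ≤ X) : (X + 4) ^ 2 + n ≤ (X + 5) ^ 2 := by
  nlinarith

/-- **Wave frequencies (general injected mode).** Given the beat frequency `q` in the ball of radius `N`,
a lattice direction `r ⊥ q` of length `≤ |q|²` and a bound `K ≥ 1` on `|k₀|²`, there is a multiple `p`
of `r` with `p ⊥ q` such that `p`, `p + q`, `p ± k₀`, `p + q ± k₀`, `2p + q` lie outside the ball, while
`|p|², |p + q|² ≤ (N² + 2N + 2K + 5)²`. -/
theorem wave_frequencies_gen (N : ℕ) {q r k₀ : Fin 3 → ℤ} (hqN : Torus.freqNormSq q ≤ (N : ℝ) ^ 2)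
    (hr : r ≠ 0) (hrq : r ⬝ᵥ q = 0) (hrq2 : Torus.freqNormSq r ≤ Torus.freqNormSq q ^ 2)
    {K : ℕ} (hK1 : 1 ≤ K) (hk₀ : Torus.freqNormSq k₀ ≤ (K : ℝ)) :
    ∃ (t : ℕ) (p : Fin 3 → ℤ), p = (fun i => (t : ℤ) * r i) ∧ p ⬝ᵥ q = 0 ∧
      (N : ℝ) ^ 2 < Torus.freqNormSq p ∧ (N : ℝ) ^ 2 < Torus.freqNormSq (p + q) ∧
      (N : ℝ) ^ 2 < Torus.freqNormSq (p + k₀) ∧ (N : ℝ) ^ 2 < Torus.freqNormSq (p - k₀) ∧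
      (N : ℝ) ^ 2 < Torus.freqNormSq (p + q + k₀) ∧ (N : ℝ) ^ 2 < Torus.freqNormSq (p + q - k₀) ∧
      (N : ℝ) ^ 2 < Torus.freqNormSq (p + (p + q)) ∧
      Torus.freqNormSq p ≤ ((N ^ 2 + 2 * N + 2 * K + 5 : ℕ) : ℝ) ^ 2 ∧
      Torus.freqNormSq (p + q) ≤ ((N ^ 2 + 2 * N + 2 * K + 5 : ℕ) : ℝ) ^ 2 := by
  have hR1 : 1 ≤ Torus.freqNormSq r := Torus.one_le_freqNormSq_of_ne_zero hr
  have hRpos : 0 < Torus.freqNormSq r := lt_of_lt_of_le one_pos hR1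
  have hsq : 0 < Real.sqrt (Torus.freqNormSq r) := Real.sqrt_pos.2 hRpos
  have hK1' : (1 : ℝ) ≤ K := by exact_mod_cast hK1
  let t : ℕ := ⌈(2 * (N : ℝ) + 2 * K + 4) / Real.sqrt (Torus.freqNormSq r)⌉₊
  let p : Fin 3 → ℤ := fun i => (t : ℤ) * r i
  have hpq : p ⬝ᵥ q = 0 := by
    show (fun i => (t : ℤ) * r i) ⬝ᵥ q = 0
    rw [natMul_dot, hrq, mul_zero]
  have hpn : Torus.freqNormSq p = ((t : ℝ) * Real.sqrt (Torus.freqNormSq r)) ^ 2 := by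
    show Torus.freqNormSq (fun i => (t : ℤ) * r i) = _
    rw [freqNormSq_natMul, mul_pow, Real.sq_sqrt hRpos.le]
  -- lower bound: `2N + 2K + 4 ≤ |p|`
  have hlow' : 2 * (N : ℝ) + 2 * K + 4 ≤ (t : ℝ) * Real.sqrt (Torus.freqNormSq r) := by
    have ht1 : (2 * (N : ℝ) + 2 * K + 4) / Real.sqrt (Torus.freqNormSq r) ≤ t := Nat.le_ceil _
    rwa [div_le_iff₀ hsq] at ht1
  have hN0 : (0 : ℝ) ≤ N := Nat.cast_nonneg N
  have hlow : (2 * (N : ℝ) + 2 * K + 4) ^ 2 ≤ Torus.freqNormSq p := by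
    rw [hpn]
    exact numeric_sq_mono (by positivity) hlow'
  -- upper bound: `|p| < 2N + 2K + 4 + |r| ≤ N² + 2N + 2K + 4`
  have hsqrt_le : Real.sqrt (Torus.freqNormSq r) ≤ (N : ℝ) ^ 2 := by
    calc Real.sqrt (Torus.freqNormSq r) ≤ Real.sqrt (Torus.freqNormSq q ^ 2) :=
          Real.sqrt_le_sqrt hrq2
      _ = Torus.freqNormSq q := Real.sqrt_sq (Torus.freqNormSq_nonneg q)
      _ ≤ (N : ℝ) ^ 2 := hqN
  have hup : Torus.freqNormSq p ≤ ((N : ℝ) ^ 2 + 2 * N + 2 * K + 4) ^ 2 := by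
    have ht2 : (t : ℝ) < (2 * (N : ℝ) + 2 * K + 4) / Real.sqrt (Torus.freqNormSq r) + 1 :=
      Nat.ceil_lt_add_one (by positivity)
    have hup' : (t : ℝ) * Real.sqrt (Torus.freqNormSq r) <
        2 * (N : ℝ) + 2 * K + 4 + Real.sqrt (Torus.freqNormSq r) := by
      have := mul_lt_mul_of_pos_right ht2 hsq
      rwa [add_mul, one_mul, div_mul_cancel₀ _ hsq.ne'] at this
    rw [hpn]
    exact numeric_sq_mono (by positivity) (by linarith)
  have hpq_norm : Torus.freqNormSq (p + q) = Torus.freqNormSq p + Torus.freqNormSq q :=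
    freqNormSq_add_of_dot_eq_zero p q hpq
  have hq0 : 0 ≤ Torus.freqNormSq q := Torus.freqNormSq_nonneg q
  have hk0 : 0 ≤ Torus.freqNormSq k₀ := Torus.freqNormSq_nonneg k₀
  have hmk : Torus.freqNormSq (-k₀) = Torus.freqNormSq k₀ := Torus.freqNormSq_neg k₀
  -- parallelogram lower bounds
  have P1 := freqNormSq_le_two_mul p k₀
  have P2 := freqNormSq_le_two_mul p (-k₀)
  have P3 := freqNormSq_le_two_mul (p + q) k₀
  have P4 := freqNormSq_le_two_mul (p + q) (-k₀)
  rw [hmk, ← sub_eq_add_neg] at P2 P4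
  rw [hpq_norm] at P3 P4
  have hpp : Torus.freqNormSq (p + (p + q)) =
      Torus.freqNormSq p + Torus.freqNormSq (p + q) + 2 * ((fun i => ((p) i : ℝ)) ⬝ᵥ (fun i => (((p + q)) i : ℝ))) :=
    freqNormSq_add_self_dot p (p + q)
  have hdot : (fun i => ((p) i : ℝ)) ⬝ᵥ (fun i => (((p + q)) i : ℝ)) = Torus.freqNormSq p := by
    rw [castR_add, dotProduct_add, ← freqNormSq_eq_castR_dot, castR_dot, hpq]; simp
  rw [hdot, hpq_norm] at hpp
  have hcast : (((N ^ 2 + 2 * N + 2 * K + 5 : ℕ) : ℝ)) = (N : ℝ) ^ 2 + 2 * N + 2 * K + 5 := by push_cast; ring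
  have hX : (0 : ℝ) ≤ (N : ℝ) ^ 2 + 2 * N + 2 * K := by positivity
  have hnX : Torus.freqNormSq q ≤ (N : ℝ) ^ 2 + 2 * N + 2 * K := by linarith
  have hnum := numeric_bound_gen hX hnX
  -- `|p|²` dominates everything in sight
  have hbig : 2 * (N : ℝ) ^ 2 + 2 * K + 2 ≤ Torus.freqNormSq p := by
    have h1 : 2 * (N : ℝ) ^ 2 + 2 * K + 2 ≤ (2 * (N : ℝ) + 2 * K + 4) ^ 2 := by nlinarith
    linarith
  have h45 : ((N : ℝ) ^ 2 + 2 * N + 2 * K + 4) ^ 2 ≤ ((N : ℝ) ^ 2 + 2 * N + 2 * K + 5) ^ 2 := by nlinarith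
  refine ⟨t, p, rfl, hpq, ?_, ?_, ?_, ?_, ?_, ?_, ?_, ?_, ?_⟩
  · linarith
  · rw [hpq_norm]; linarith
  · linarith
  · linarith
  · linarith
  · linarith
  · rw [hpp]; linarith
  · rw [hcast]; linarith
  · rw [hcast, hpq_norm]; linarith

/-! ### §F.2 Exact inertial evaluations for a general injected mode -/

/-- Inertial term of a single transversal mode against any smooth field: zero (no self-interaction). -/
theorem inertial_mode_zero {G : (UnitAddTorus (Fin 3)) → (EuclideanSpace ℝ (Fin 3))} (hG : Torus.IsSmooth G)
    (k₀ : Fin 3 → ℤ) (zs : (EuclideanSpace ℂ (Fin 3))) (hs : ((fun j => ((k₀) j : ℂ)) ⬝ᵥ (WithLp.ofLp (zs))) = 0) :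
    ∫ x, ⟪Torus.fderiv G x ((∑ mm, Torus.realTrigPoly {![k₀] mm} (fun _ => ![zs] mm)) x),
      (∑ mm, Torus.realTrigPoly {![k₀] mm} (fun _ => ![zs] mm)) x⟫_ℝ = 0 := by
  rw [inertial_modes hG]
  have d00 : ((fun j => (((k₀ + k₀)) j : ℂ)) ⬝ᵥ (WithLp.ofLp (zs))) = 0 := by rw [dotc_add_left, hs, add_zero]
  simp only [Fin.sum_univ_one, Matrix.cons_val_fin_one, sub_self, dotc_zero_left,
    d00, zero_mul, mul_zero, map_zero, Complex.zero_im, add_zero]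

set_option maxHeartbeats 1000000 in
/-- **The injected beat.** Inertial term of a transversal mode at `k₀` plus two transversal waves at `p`,
`p + q` against a smooth `G` whose coefficients vanish at `k₀ ± p`, `k₀ ± (p+q)` (up to sign), `2p + q`
and `0`, and whose coefficient at `-q` is orthogonal to `zA`: only the `(p, p+q)` BEAT at `q` survives. -/
theorem inertial_beat_gen {G : (UnitAddTorus (Fin 3)) → (EuclideanSpace ℝ (Fin 3))} (hG : Torus.IsSmooth G)
    (k₀ p q : Fin 3 → ℤ) (zs zA zB : (EuclideanSpace ℂ (Fin 3)))
    (hs : ((fun j => ((k₀) j : ℂ)) ⬝ᵥ (WithLp.ofLp (zs))) = 0)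
    (hA : ((fun j => ((p) j : ℂ)) ⬝ᵥ (WithLp.ofLp (zA))) = 0)
    (hB : ((fun j => (((p + q)) j : ℂ)) ⬝ᵥ (WithLp.ofLp (zB))) = 0)
    (h1 : (mFourierCoeff (EuclideanSpace.complexify ∘ G) (k₀ + p)) = 0)
    (h2 : (mFourierCoeff (EuclideanSpace.complexify ∘ G) (p - k₀)) = 0)
    (h3 : (mFourierCoeff (EuclideanSpace.complexify ∘ G) (p + k₀)) = 0)
    (h4 : (mFourierCoeff (EuclideanSpace.complexify ∘ G) (k₀ - p)) = 0)
    (h5 : (mFourierCoeff (EuclideanSpace.complexify ∘ G) (k₀ + (p + q))) = 0)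
    (h6 : (mFourierCoeff (EuclideanSpace.complexify ∘ G) ((p + q) - k₀)) = 0)
    (h7 : (mFourierCoeff (EuclideanSpace.complexify ∘ G) ((p + q) + k₀)) = 0)
    (h8 : (mFourierCoeff (EuclideanSpace.complexify ∘ G) (k₀ - (p + q))) = 0)
    (h9 : (mFourierCoeff (EuclideanSpace.complexify ∘ G) (p + (p + q))) = 0)
    (h10 : (mFourierCoeff (EuclideanSpace.complexify ∘ G) ((p + q) + p)) = 0)
    (hAq : ⟪(mFourierCoeff (EuclideanSpace.complexify ∘ G) (-q)), zA⟫_ℂ = 0) :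
    ∫ x, ⟪Torus.fderiv G x ((∑ mm, Torus.realTrigPoly {![k₀, p, p + q] mm} (fun _ => ![zs, zA, zB] mm)) x),
        (∑ mm, Torus.realTrigPoly {![k₀, p, p + q] mm} (fun _ => ![zs, zA, zB] mm)) x⟫_ℝ =
      Real.pi * (conj (((fun j => ((q) j : ℂ)) ⬝ᵥ (WithLp.ofLp (zA)))) * ⟪(mFourierCoeff (EuclideanSpace.complexify ∘ G) q), zB⟫_ℂ).im := by
  rw [inertial_modes hG]
  have e1 : p + q - p = q := add_sub_cancel_left p q
  have e2' : p - (p + q) = -q := by abel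
  have d00 : ((fun j => (((k₀ + k₀)) j : ℂ)) ⬝ᵥ (WithLp.ofLp (zs))) = 0 := by rw [dotc_add_left, hs, add_zero]
  have d11 : ((fun j => (((p + p)) j : ℂ)) ⬝ᵥ (WithLp.ofLp (zA))) = 0 := by rw [dotc_add_left, hA, add_zero]
  have d22 : ((fun j => (((p + q + (p + q))) j : ℂ)) ⬝ᵥ (WithLp.ofLp (zB))) = 0 := by rw [dotc_add_left, hB, add_zero]
  have hA2 : ((fun j => (((p + q - p)) j : ℂ)) ⬝ᵥ (WithLp.ofLp (zA))) = ((fun j => ((q) j : ℂ)) ⬝ᵥ (WithLp.ofLp (zA))) := by rw [e1]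
  simp only [Fin.sum_univ_three, Matrix.cons_val_zero, Matrix.cons_val_one, Matrix.cons_val_two,
    Matrix.head_cons, Matrix.tail_cons, sub_self, dotc_zero_left, d00, d11, d22, hA2, e2',
    h1, h2, h3, h4, h5, h6, h7, h8, h9, h10, hAq, zero_mul, mul_zero, map_zero,
    inner_zero_left, Complex.zero_im, add_zero, zero_add]
  rw [e1]

/-! ### §F.3 Invisibility of the waves; the Laplacian pairing -/

/-- The coordinates of the injected beat state and of the injected mode agree: the waves outside the band
are invisible to the band-limited test fields. -/
theorem coords_waves_invisible (Φ : Torus.CylindricalTest (Fin 3)) {N : ℕ}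
    (hΦ : ∀ i, Torus.fourierTruncate N (Φ.g i) = Φ.g i) {k₀ p q : Fin 3 → ℤ} {zs zA zB : (EuclideanSpace ℂ (Fin 3))}
    (hNp : (N : ℝ) ^ 2 < Torus.freqNormSq p) (hNpq : (N : ℝ) ^ 2 < Torus.freqNormSq (p + q))
    {uw ue : (Torus.energySpace (Fin 3))}
    (huw : (((uw : (Torus.energySpace (Fin 3))) : (Lp (EuclideanSpace ℝ (Fin 3)) 2 (volume : Measure (UnitAddTorus (Fin 3))))) : (UnitAddTorus (Fin 3)) → (EuclideanSpace ℝ (Fin 3))) =ᵐ[volume] (∑ mm, Torus.realTrigPoly {![k₀, p, p + q] mm} (fun _ => ![zs, zA, zB] mm)))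
    (hue : (((ue : (Torus.energySpace (Fin 3))) : (Lp (EuclideanSpace ℝ (Fin 3)) 2 (volume : Measure (UnitAddTorus (Fin 3))))) : (UnitAddTorus (Fin 3)) → (EuclideanSpace ℝ (Fin 3))) =ᵐ[volume] (∑ mm, Torus.realTrigPoly {![k₀] mm} (fun _ => ![zs] mm))) :
    Φ.coords uw = Φ.coords ue := by
  ext i
  rw [coords_of_ae huw, coords_of_ae hue, integral_inner_modes_left (Φ.g_smooth i).integrable,
    integral_inner_modes_left (Φ.g_smooth i).integrable]
  simp only [Fin.sum_univ_three, Fin.sum_univ_one, Matrix.cons_val_zero, Matrix.cons_val_one,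
    Matrix.cons_val_two, Matrix.head_cons, Matrix.tail_cons, Fin.isValue, Matrix.cons_val_fin_one]
  rw [fc_g_eq_zero Φ hΦ i p hNp, fc_g_eq_zero Φ hΦ i (p + q) hNpq, inner_zero_right, inner_zero_right,
    Complex.zero_re, add_zero, add_zero]

/-- One Laplacian term in Fourier variables at a general frequency, bounded by the truncated norm:
`|Re⟪z, −4π²|k₀|² Ĝ(k₀)⟫| ≤ ‖z‖ · 4π²|k₀|² · 𝔊`. -/
theorem laplacian_coeff_le {G : (UnitAddTorus (Fin 3)) → (EuclideanSpace ℝ (Fin 3))} {N : ℕ}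
    (hband : ∀ κ, (N : ℝ) ^ 2 < Torus.freqNormSq κ → mFourierCoeff (EuclideanSpace.complexify ∘ G) κ = 0)
    (k₀ : Fin 3 → ℤ) (zs : (EuclideanSpace ℂ (Fin 3))) :
    |(⟪zs, -(((4 * Real.pi ^ 2 * Torus.freqNormSq k₀ : ℝ) : ℂ) • (mFourierCoeff (EuclideanSpace.complexify ∘ G) k₀))⟫_ℂ).re| ≤
      ‖zs‖ * (4 * Real.pi ^ 2 * Torus.freqNormSq k₀) * (Real.sqrt (∑ κ' ∈ Torus.freqBall N, ‖mFourierCoeff (EuclideanSpace.complexify ∘ G) κ'‖ ^ 2)) := by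
  refine (abs_re_inner_le_norm_mul _ _).trans ?_
  have h4 : (0 : ℝ) ≤ 4 * Real.pi ^ 2 * Torus.freqNormSq k₀ := by
    have := Torus.freqNormSq_nonneg k₀
    positivity
  rw [norm_neg, norm_smul, Complex.norm_real, Real.norm_of_nonneg h4]
  have h := norm_fc_le_coeffNorm hband k₀
  have hz := norm_nonneg zs
  calc ‖zs‖ * (4 * Real.pi ^ 2 * Torus.freqNormSq k₀ * ‖(mFourierCoeff (EuclideanSpace.complexify ∘ G) k₀)‖)
      = (‖zs‖ * (4 * Real.pi ^ 2 * Torus.freqNormSq k₀)) * ‖(mFourierCoeff (EuclideanSpace.complexify ∘ G) k₀)‖ := by ring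
    _ ≤ (‖zs‖ * (4 * Real.pi ^ 2 * Torus.freqNormSq k₀)) * (Real.sqrt (∑ κ' ∈ Torus.freqBall N, ‖mFourierCoeff (EuclideanSpace.complexify ∘ G) κ'‖ ^ 2)) :=
        mul_le_mul_of_nonneg_left h (mul_nonneg hz h4)

/-- The Laplacian pairing of the injected mode. -/
theorem laplacian_one_le {G : (UnitAddTorus (Fin 3)) → (EuclideanSpace ℝ (Fin 3))} (hG : Torus.IsSmooth G) {N : ℕ}
    (hband : ∀ κ, (N : ℝ) ^ 2 < Torus.freqNormSq κ → mFourierCoeff (EuclideanSpace.complexify ∘ G) κ = 0)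
    (k₀ : Fin 3 → ℤ) (zs : (EuclideanSpace ℂ (Fin 3))) :
    |∫ x, ⟪(∑ mm, Torus.realTrigPoly {![k₀] mm} (fun _ => ![zs] mm)) x, Torus.laplacian G x⟫_ℝ| ≤
      ‖zs‖ * (4 * Real.pi ^ 2 * Torus.freqNormSq k₀) * (Real.sqrt (∑ κ' ∈ Torus.freqBall N, ‖mFourierCoeff (EuclideanSpace.complexify ∘ G) κ'‖ ^ 2)) := by
  rw [integral_inner_modes_laplacian hG]
  simp only [Fin.sum_univ_one, Matrix.cons_val_fin_one]
  exact laplacian_coeff_le hband k₀ zs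

/-- The Laplacian pairing of the injected beat state: the two waves outside the band do not contribute. -/
theorem laplacian_three_le {G : (UnitAddTorus (Fin 3)) → (EuclideanSpace ℝ (Fin 3))} (hG : Torus.IsSmooth G) {N : ℕ}
    (hband : ∀ κ, (N : ℝ) ^ 2 < Torus.freqNormSq κ → mFourierCoeff (EuclideanSpace.complexify ∘ G) κ = 0)
    (k₀ : Fin 3 → ℤ) (zs zA zB : (EuclideanSpace ℂ (Fin 3))) {p q : Fin 3 → ℤ}
    (hp : (mFourierCoeff (EuclideanSpace.complexify ∘ G) p) = 0) (hpq : (mFourierCoeff (EuclideanSpace.complexify ∘ G) (p + q)) = 0) :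
    |∫ x, ⟪(∑ mm, Torus.realTrigPoly {![k₀, p, p + q] mm} (fun _ => ![zs, zA, zB] mm)) x, Torus.laplacian G x⟫_ℝ| ≤
      ‖zs‖ * (4 * Real.pi ^ 2 * Torus.freqNormSq k₀) * (Real.sqrt (∑ κ' ∈ Torus.freqBall N, ‖mFourierCoeff (EuclideanSpace.complexify ∘ G) κ'‖ ^ 2)) := by
  rw [integral_inner_modes_laplacian hG]
  simp only [Fin.sum_univ_three, Matrix.cons_val_zero, Matrix.cons_val_one, Matrix.cons_val_two,
    Matrix.head_cons, Matrix.tail_cons, hp, hpq, smul_zero, neg_zero, inner_zero_right,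
    Complex.zero_re, add_zero, Fin.isValue]
  exact laplacian_coeff_le hband k₀ zs

/-! ### §F.4 The injected mode of the force -/

/-- A smooth mean-zero field with positive energy has a nonzero Fourier mode at a nonzero frequency. -/
theorem exists_fc_ne_zero_of_force {f : (UnitAddTorus (Fin 3)) → (EuclideanSpace ℝ (Fin 3))} (hf : Torus.IsSmooth f)
    (hmean : Torus.HasZeroMean f) (hpos : 0 < ∫ x, ‖f x‖ ^ 2) :
    ∃ k₀ : Fin 3 → ℤ, k₀ ≠ 0 ∧ mFourierCoeff (EuclideanSpace.complexify ∘ f) k₀ ≠ 0 := by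
  by_contra h
  push Not at h
  have hall : ∀ κ, mFourierCoeff (EuclideanSpace.complexify ∘ f) κ = 0 := by
    intro κ
    by_cases hκ : κ = 0
    · rw [hκ]; exact Torus.mFourierCoeff_complexify_zero_of_hasZeroMean hf.integrable hmean
    · exact h κ hκ
  have hzero : (EuclideanSpace.complexify ∘ f) = 0 :=
    Torus.eq_zero_of_forall_mFourierCoeff_eq_zero hf.complexify_comp.continuous hall
  have hf0 : ∀ x, f x = 0 := by
    intro x
    have hx := congrFun hzero x
    simp only [Function.comp_apply, Pi.zero_apply] at hx
    have hn : ‖f x‖ = 0 := by rw [← EuclideanSpace.norm_complexify, hx, norm_zero]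
    exact norm_eq_zero.1 hn
  have : (∫ x, ‖f x‖ ^ 2) = 0 := by simp [hf0]
  linarith

/-- The energy input of the injected mode: `(Re(e_{k₀} σ ĉ), f) = σ ‖ĉ‖²` for `ĉ = f̂(k₀)`. -/
theorem injection_value {f : (UnitAddTorus (Fin 3)) → (EuclideanSpace ℝ (Fin 3))} (k₀ : Fin 3 → ℤ) (σ : ℝ) :
    (⟪((σ : ℂ) • mFourierCoeff (EuclideanSpace.complexify ∘ f) k₀), mFourierCoeff (EuclideanSpace.complexify ∘ f) k₀⟫_ℂ).re =
      σ * ‖mFourierCoeff (EuclideanSpace.complexify ∘ f) k₀‖ ^ 2 := by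
  rw [inner_smul_left, Complex.conj_ofReal, Complex.re_ofReal_mul]
  congr 1
  have h := inner_self_eq_norm_sq (𝕜 := ℂ) (mFourierCoeff (EuclideanSpace.complexify ∘ f) k₀)
  simpa using h

/-- Norm of the injected polarisation `σ ĉ`: `‖σ ĉ‖ = σ ‖ĉ‖` for `σ ≥ 0`. -/
theorem norm_injected {σ : ℝ} (hσ : 0 ≤ σ) (c : (EuclideanSpace ℂ (Fin 3))) : ‖((σ : ℂ) • c)‖ = σ * ‖c‖ := by
  rw [norm_smul, Complex.norm_real, Real.norm_of_nonneg hσ]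

/-- Transversality of the injected polarisation: `k₀ · (σ ĉ) = 0` for a solenoidal `f`. -/
theorem dotc_injected {f : (UnitAddTorus (Fin 3)) → (EuclideanSpace ℝ (Fin 3))} (hf : Torus.IsSmooth f) (hdiv : Torus.IsDivFree f)
    (k₀ : Fin 3 → ℤ) (σ : ℝ) :
    ((fun j => ((k₀) j : ℂ)) ⬝ᵥ (WithLp.ofLp (((σ : ℂ) • mFourierCoeff (EuclideanSpace.complexify ∘ f) k₀)))) = 0 := by
  rw [dotc_smul]
  have h : ((fun j => ((k₀) j : ℂ)) ⬝ᵥ (WithLp.ofLp ((mFourierCoeff (EuclideanSpace.complexify ∘ f) k₀)))) = 0 :=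
    hdiv.sum_mul_mFourierCoeff_eq_zero hf k₀
  rw [h, mul_zero]

/-! ### §F.5 Membership facts for the mode vectors -/

/-- The injected frequency vector has nonzero entries. -/
theorem one_ne_zero_gen {k₀ : Fin 3 → ℤ} (hk₀ : k₀ ≠ 0) : ∀ m, (![k₀] : Fin 1 → (Fin 3 → ℤ)) m ≠ 0 := by
  intro m; fin_cases m; exact hk₀

/-- Transversality of the injected polarisation vector. -/
theorem one_dotc_gen {k₀ : Fin 3 → ℤ} {z₀ : (EuclideanSpace ℂ (Fin 3))} (h0 : ((fun j => ((k₀) j : ℂ)) ⬝ᵥ (WithLp.ofLp (z₀))) = 0) :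
    ∀ m, ((fun j => ((((![k₀] : Fin 1 → (Fin 3 → ℤ)) m)) j : ℂ)) ⬝ᵥ (WithLp.ofLp (((![z₀] : Fin 1 → (EuclideanSpace ℂ (Fin 3))) m)))) = 0 := by
  intro m; fin_cases m; exact h0

/-- The injected frequency lies in the ball of radius `L` once `|k₀|² ≤ L²`. -/
theorem one_freq_le_gen {k₀ : Fin 3 → ℤ} {L : ℕ} (hk : Torus.freqNormSq k₀ ≤ (L : ℝ) ^ 2) :
    ∀ m, Torus.freqNormSq ((![k₀] : Fin 1 → (Fin 3 → ℤ)) m) ≤ (L : ℝ) ^ 2 := by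
  intro m; fin_cases m; exact hk

/-- The three frequencies of the injected beat state are nonzero. -/
theorem three_ne_zero_gen {k₀ p q : Fin 3 → ℤ} (hk₀ : k₀ ≠ 0) (hp : p ≠ 0) (hpq : p + q ≠ 0) :
    ∀ m, (![k₀, p, p + q] : Fin 3 → (Fin 3 → ℤ)) m ≠ 0 := by
  intro m
  fin_cases m
  · exact hk₀
  · exact hp
  · exact hpq

/-- Transversality of the three polarisations of the injected beat state. -/
theorem three_dotc_gen {k₀ p q : Fin 3 → ℤ} {z₀ zA zB : (EuclideanSpace ℂ (Fin 3))}
    (h0 : ((fun j => ((k₀) j : ℂ)) ⬝ᵥ (WithLp.ofLp (z₀))) = 0)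
    (hA : ((fun j => ((p) j : ℂ)) ⬝ᵥ (WithLp.ofLp (zA))) = 0)
    (hB : ((fun j => (((p + q)) j : ℂ)) ⬝ᵥ (WithLp.ofLp (zB))) = 0) :
    ∀ m, ((fun j => ((((![k₀, p, p + q] : Fin 3 → (Fin 3 → ℤ)) m)) j : ℂ)) ⬝ᵥ (WithLp.ofLp (((![z₀, zA, zB] : Fin 3 → (EuclideanSpace ℂ (Fin 3))) m)))) = 0 := by
  intro m
  fin_cases m
  · exact h0
  · exact hA
  · exact hB

/-- The three frequencies of the injected beat state lie in the ball of radius `L`. -/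
theorem three_freq_le_gen {k₀ p q : Fin 3 → ℤ} {L : ℕ} (hk : Torus.freqNormSq k₀ ≤ (L : ℝ) ^ 2)
    (hp : Torus.freqNormSq p ≤ (L : ℝ) ^ 2) (hpq : Torus.freqNormSq (p + q) ≤ (L : ℝ) ^ 2) :
    ∀ m, Torus.freqNormSq ((![k₀, p, p + q] : Fin 3 → (Fin 3 → ℤ)) m) ≤ (L : ℝ) ^ 2 := by
  intro m
  fin_cases m
  · exact hk
  · exact hp
  · exact hpq

/-! ### §F.7 Arithmetic: the gain of the beat and the viscosity threshold -/

/-- **The gain of the injected beat** dominates the truncated norm linearly: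
`(F + 2) 𝔊 ≤ π α² √|q|² |ζ|` once `π α² = (F + 2) Λ`, `Λ² = 2 #ball`, `𝔊² ≤ #ball ‖ĝ‖²`, `‖ĝ‖² ≤ 2|ζ|²`. -/
theorem gain_gen {F Λ α 𝔊 card gn ζn fq : ℝ} (hF : 0 ≤ F + 2) (h𝔊 : 0 ≤ 𝔊) (hΛ : 0 ≤ Λ)
    (hΛsq : Λ ^ 2 = 2 * card) (hα : Real.pi * α ^ 2 = (F + 2) * Λ) (hg : 𝔊 ^ 2 ≤ card * gn ^ 2)
    (hζ : gn ^ 2 ≤ 2 * ζn ^ 2) (hζn : 0 ≤ ζn) (hfq : 1 ≤ fq) :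
    (F + 2) * 𝔊 ≤ Real.pi * α * α * Real.sqrt fq * ζn := by
  have h1 : 𝔊 ^ 2 ≤ (Λ * ζn) ^ 2 := by
    rw [mul_pow, hΛsq]; nlinarith
  have h2 : 𝔊 ≤ Λ * ζn := (pow_le_pow_iff_left₀ h𝔊 (mul_nonneg hΛ hζn) two_ne_zero).1 h1
  have h3 : 1 ≤ Real.sqrt fq := Real.one_le_sqrt.2 hfq
  have h4 : 0 ≤ Real.pi * α ^ 2 * ζn := by positivity
  calc (F + 2) * 𝔊 ≤ (F + 2) * (Λ * ζn) := mul_le_mul_of_nonneg_left h2 hF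
    _ = Real.pi * α ^ 2 * ζn * 1 := by rw [← mul_assoc, ← hα]; ring
    _ ≤ Real.pi * α ^ 2 * ζn * Real.sqrt fq := mul_le_mul_of_nonneg_left h3 h4
    _ = Real.pi * α * α * Real.sqrt fq * ζn := by ring

/-- One upper-bound demand on the viscosity. -/
theorem demand_of_le_div {ν a b : ℝ} (hν : 0 < ν) (ha : 0 ≤ a) (_hb : 0 < b) (h : ν ≤ b / (a + 1)) : ν * a ≤ b := by
  have ha1 : 0 < a + 1 := by linarith
  calc ν * a ≤ ν * (a + 1) := by nlinarith
    _ ≤ b / (a + 1) * (a + 1) := mul_le_mul_of_nonneg_right h ha1.le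
    _ = b := div_mul_cancel₀ _ ha1.ne'

/-- **The viscosity threshold**: four upper-bound demands `ν · aᵢ ≤ bᵢ` hold for all `ν` below an
explicit positive `ν₁`. -/
theorem exists_threshold {a₁ a₂ a₃ a₄ b₁ b₂ b₃ b₄ : ℝ} (ha₁ : 0 ≤ a₁) (ha₂ : 0 ≤ a₂) (ha₃ : 0 ≤ a₃) (ha₄ : 0 ≤ a₄)
    (hb₁ : 0 < b₁) (hb₂ : 0 < b₂) (hb₃ : 0 < b₃) (hb₄ : 0 < b₄) :
    ∃ ν₁ : ℝ, 0 < ν₁ ∧ ∀ ν : ℝ, 0 < ν → ν ≤ ν₁ →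
      ν * a₁ ≤ b₁ ∧ ν * a₂ ≤ b₂ ∧ ν * a₃ ≤ b₃ ∧ ν * a₄ ≤ b₄ := by
  refine ⟨min (min (b₁ / (a₁ + 1)) (b₂ / (a₂ + 1))) (min (b₃ / (a₃ + 1)) (b₄ / (a₄ + 1))), ?_, ?_⟩
  · have h1 : 0 < b₁ / (a₁ + 1) := div_pos hb₁ (by linarith)
    have h2 : 0 < b₂ / (a₂ + 1) := div_pos hb₂ (by linarith)
    have h3 : 0 < b₃ / (a₃ + 1) := div_pos hb₃ (by linarith)
    have h4 : 0 < b₄ / (a₄ + 1) := div_pos hb₄ (by linarith)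
    exact lt_min (lt_min h1 h2) (lt_min h3 h4)
  · intro ν hν hle
    refine ⟨demand_of_le_div hν ha₁ hb₁ ?_, demand_of_le_div hν ha₂ hb₂ ?_,
      demand_of_le_div hν ha₃ hb₃ ?_, demand_of_le_div hν ha₄ hb₄ ?_⟩
    · exact hle.trans ((min_le_left _ _).trans (min_le_left _ _))
    · exact hle.trans ((min_le_left _ _).trans (min_le_right _ _))
    · exact hle.trans ((min_le_right _ _).trans (min_le_left _ _))
    · exact hle.trans ((min_le_right _ _).trans (min_le_right _ _))

end Summit.AnomalousDissipation.AnomalousDissipation.Theorems.FloorCertificate.Negative
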